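import Summits.CriticalPhenomena.CardyFormulaZ2.Theorems.CardyComplexConeParafermionToSLESixFamiliesDiamondIdentifyBoundaryArg
import Mathlib.Topology.Piecewise
import HarnessLib

/-!
# Line `potential-darboux-picard-diamond`, stub S4′ (`stub_identifyPotentialPh`): the arguments of the boundary loop and of the boundary trace over two periods

Helper file of the stub `stub_identifyPotentialPh` of crux `ParafermionToSLESixFamilies` (stmt-CriticalPhenomena-11389).
Step (iv) of the identification needs continuous arguments, over TWO periods `[0, 4π]` (the reparametrisation between
the Riemann-map boundary correspondence and the loop may shift by up to one period), of (1) the boundary loop `ℓ` of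
the diamond about its centre `c` — STRICTLY increasing (`exists_loopArg`, registered helper of the crux item: the
`N`-piece chain data of `exists_boundaryChain` feed `monotoneArg_of_pieces` with unit piece directions; strictness from
"one frontier point per ray", `eq_of_frontier_of_sameRay`, and injectivity of the loop on a period), and (2) the
boundary trace `G ∘ ℓ` about an interior point `w₀` of the limit polygon — non-decreasing (`exists_traceArg`). Both rest
on the one-period statement `monotoneArg_of_pieces` and the period-doubling extension `arg_extend`; the closing of the
direction chain `d_N = d_0` is `dir_eq_mul_exp_sum`.
-/

noncomputable section

namespace Summit.CriticalPhenomena.CardyFormulaZ2.Cruxes.ParafermionToSLESixFamilies.PotentialDarbouxPicardDiamond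

open scoped Topology ComplexConjugate BigOperators
open Filter Set Metric Complex
open Literature.Probability.RandomPlanarGeometry

/-! ## Period doubling of a continuous argument -/

/-- **Extending a continuous argument from one period to two.** -/
theorem arg_extend (γ : ℝ → ℂ) (w₀ : ℂ) (θ₀ : ℝ → ℝ) {L : ℝ} (hL : 0 < L) (hγper : ∀ s, γ (s + L) = γ s)
    (hθc : ContinuousOn θ₀ (Icc 0 L)) (hθm : MonotoneOn θ₀ (Icc 0 L)) (hθL : θ₀ L = θ₀ 0 + 2 * Real.pi)
    (hpol : ∀ s ∈ Icc 0 L, γ s - w₀ = (‖γ s - w₀‖ : ℂ) * exp (θ₀ s * I)) :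
    ∃ Θ : ℝ → ℝ, ContinuousOn Θ (Icc 0 (2 * L)) ∧ MonotoneOn Θ (Icc 0 (2 * L)) ∧ (∀ s ∈ Icc 0 L, Θ s = θ₀ s) ∧
      (∀ s ∈ Icc 0 L, Θ (s + L) = θ₀ s + 2 * Real.pi) ∧
      (∀ s ∈ Icc 0 (2 * L), γ s - w₀ = (‖γ s - w₀‖ : ℂ) * exp (Θ s * I)) ∧
      (StrictMonoOn θ₀ (Icc 0 L) → StrictMonoOn Θ (Icc 0 (2 * L))) := by
  set Θ : ℝ → ℝ := fun s => if s ≤ L then θ₀ s else θ₀ (s - L) + 2 * Real.pi with hΘ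
  have hΘ1 : ∀ s, s ≤ L → Θ s = θ₀ s := fun s hs => by simp only [hΘ, if_pos hs]
  have hΘ2 : ∀ s, L < s → Θ s = θ₀ (s - L) + 2 * Real.pi := fun s hs => by simp only [hΘ, if_neg (not_le.2 hs)]
  have hΘ2' : ∀ s ∈ Icc 0 L, Θ (s + L) = θ₀ s + 2 * Real.pi := by
    intro s hs
    rcases hs.1.eq_or_lt with rfl | hpos
    · rw [zero_add, hΘ1 L le_rfl, hθL]
    · rw [hΘ2 (s + L) (by linarith), add_sub_cancel_right]
  refine ⟨Θ, ?_, ?_, fun s hs => hΘ1 s hs.2, hΘ2', ?_, ?_⟩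
  · -- continuity
    simp only [hΘ]
    refine ContinuousOn.if ?_ ?_ ?_
    · rintro a ⟨-, ha⟩
      have hfr : frontier {a : ℝ | a ≤ L} = {L} := by
        rw [show {a : ℝ | a ≤ L} = Iic L from rfl, frontier_Iic]
      rw [hfr, mem_singleton_iff] at ha
      rw [ha, sub_self, hθL]
    · have hcl : closure {a : ℝ | a ≤ L} = Iic L := by rw [show {a : ℝ | a ≤ L} = Iic L from rfl, closure_Iic]
      rw [hcl]
      exact hθc.mono fun s hs => ⟨hs.1.1, hs.2⟩
    · have hcl : closure {a : ℝ | ¬a ≤ L} = Ici L := by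
        rw [show {a : ℝ | ¬a ≤ L} = Ioi L by ext; simp, closure_Ioi]
      rw [hcl]
      refine (hθc.comp (continuous_sub_right L).continuousOn fun s hs => ?_).add continuousOn_const
      have h2 : L ≤ s := hs.2
      have h3 : s ≤ 2 * L := hs.1.2
      exact ⟨by linarith, by linarith⟩
  · -- monotonicity
    intro s hs s' hs' hss'
    by_cases h1 : s ≤ L <;> by_cases h2 : s' ≤ L
    · rw [hΘ1 s h1, hΘ1 s' h2]; exact hθm ⟨hs.1, h1⟩ ⟨hs'.1, h2⟩ hss'
    · rw [hΘ1 s h1, hΘ2 s' (not_le.1 h2)]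
      have a1 : θ₀ s ≤ θ₀ L := hθm ⟨hs.1, h1⟩ ⟨hL.le, le_rfl⟩ h1
      have a2 : θ₀ 0 ≤ θ₀ (s' - L) :=
        hθm ⟨le_rfl, hL.le⟩ ⟨by linarith [not_le.1 h2], by linarith [hs'.2]⟩ (by linarith [not_le.1 h2])
      linarith
    · exfalso; exact h1 (hss'.trans h2)
    · rw [hΘ2 s (not_le.1 h1), hΘ2 s' (not_le.1 h2)]
      have := hθm ⟨by linarith [not_le.1 h1], by linarith [hs.2]⟩ ⟨by linarith [not_le.1 h2], by linarith [hs'.2]⟩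
        (by linarith : s - L ≤ s' - L)
      linarith
  · -- polar representation
    intro s hs
    by_cases h1 : s ≤ L
    · rw [hΘ1 s h1]; exact hpol s ⟨hs.1, h1⟩
    · rw [hΘ2 s (not_le.1 h1)]
      have hs' : s - L ∈ Icc 0 L := ⟨by linarith [not_le.1 h1], by linarith [hs.2]⟩
      have hγ : γ s = γ (s - L) := by rw [← hγper (s - L), sub_add_cancel]
      have hexp : exp (((θ₀ (s - L) + 2 * Real.pi : ℝ) : ℂ) * I) = exp ((θ₀ (s - L) : ℂ) * I) := by
        rw [show ((θ₀ (s - L) + 2 * Real.pi : ℝ) : ℂ) * I = (θ₀ (s - L) : ℂ) * I + 2 * Real.pi * I by push_cast; ring,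
          Complex.exp_add, exp_two_pi_mul_I, mul_one]
      rw [hexp, hγ]
      exact hpol _ hs'
  · -- strict monotonicity
    intro hstrict s hs s' hs' hss'
    by_cases h1 : s ≤ L <;> by_cases h2 : s' ≤ L
    · rw [hΘ1 s h1, hΘ1 s' h2]; exact hstrict ⟨hs.1, h1⟩ ⟨hs'.1, h2⟩ hss'
    · rw [hΘ1 s h1, hΘ2 s' (not_le.1 h2)]
      have a1 : θ₀ s ≤ θ₀ L := hθm ⟨hs.1, h1⟩ ⟨hL.le, le_rfl⟩ h1
      have a2 : θ₀ 0 < θ₀ (s' - L) :=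
        hstrict ⟨le_rfl, hL.le⟩ ⟨by linarith [not_le.1 h2], by linarith [hs'.2]⟩ (by linarith [not_le.1 h2])
      linarith
    · exfalso; exact h1 (hss'.le.trans h2)
    · rw [hΘ2 s (not_le.1 h1), hΘ2 s' (not_le.1 h2)]
      have := hstrict ⟨by linarith [not_le.1 h1], by linarith [hs.2]⟩ ⟨by linarith [not_le.1 h2], by linarith [hs'.2]⟩
        (by linarith : s - L < s' - L)
      linarith

/-! ## Closing of the direction chain -/

/-- `d_n = d_0 · exp (i Σ_{j<n} θ_j)`. -/
theorem dir_eq_mul_exp_sum {d : ℕ → ℂ} {θ : ℕ → ℝ} (hd : ∀ j, d (j + 1) = d j * exp (θ j * I)) (n : ℕ) :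
    d n = d 0 * exp ((∑ j ∈ Finset.range n, θ j : ℝ) * I) := by
  induction n with
  | zero => simp
  | succ n ih =>
    rw [hd n, ih, Finset.sum_range_succ, mul_assoc, ← Complex.exp_add]
    congr 2; push_cast; ring

/-- With `N`-periodic turning angles adding up to `2π` over a period, the direction chain closes: `d_N = d_0`, and all
directions are non-zero if `d_0` is. -/
theorem dir_closes {d : ℕ → ℂ} {θ : ℕ → ℝ} {N : ℕ} (hd : ∀ j, d (j + 1) = d j * exp (θ j * I))
    (hsum : ∑ j ∈ Finset.range N, θ j = 2 * Real.pi) (hd0 : d 0 ≠ 0) : d N = d 0 ∧ ∀ j, d j ≠ 0 := by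
  refine ⟨by rw [dir_eq_mul_exp_sum hd N, hsum]; push_cast; rw [exp_two_pi_mul_I, mul_one], fun j => ?_⟩
  rw [dir_eq_mul_exp_sum hd j]; exact mul_ne_zero hd0 (exp_ne_zero _)

/-! ## The argument of the boundary loop -/

/-- **The argument of the boundary loop about the centre, over two periods.** -/
theorem exists_loopArg : ∀ (D : DobrushinDomain) (N : ℕ) (ℓ : ℝ → ℂ) (t : ℕ → ℝ) (c : ℂ) (K' : Set ℂ), 0 < N → c ∈ D.carrier → Continuous ℓ → (∀ s : ℝ, ℓ (s + 2 * Real.pi) = ℓ s) → Set.InjOn ℓ (Set.Ico 0 (2 * Real.pi)) → t 0 = 0 → (∀ j, t j < t (j + 1)) → (∀ j, t (j + N) = t j + 2 * Real.pi) → (∀ j, IsBdrySegment D (ℓ (t j)) (ℓ (t (j + 1)))) → (∀ (j : ℕ) (s : ℝ), t j ≤ s → s ≤ t (j + 1) → ℓ s = ℓ (t j) + (((s - t j) / (t (j + 1) - t j) : ℝ) : ℂ) * (ℓ (t (j + 1)) - ℓ (t j))) → (∀ j, ((ℓ (t (j + 2)) - ℓ (t (j + 1))) / (ℓ (t (j +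 1)) - ℓ (t j))).arg = 0 ∨ ((ℓ (t (j + 2)) - ℓ (t (j + 1))) / (ℓ (t (j + 1)) - ℓ (t j))).arg = Real.pi / 2) → ∑ j ∈ Finset.range N, ((ℓ (t (j + 2)) - ℓ (t (j + 1))) / (ℓ (t (j + 1)) - ℓ (t j))).arg = 2 * Real.pi → Convex ℝ K' → c ∈ interior K' → (∀ s, ℓ s ∈ frontier K') → ∃ Θ : ℝ → ℝ, ContinuousOn Θ (Set.Icc 0 (4 * Real.pi)) ∧ StrictMonoOn Θ (Set.Icc 0 (4 * Real.pi)) ∧ (∀ s ∈ Set.Icc 0 (2 * Real.pi), Θ (s + 2 * Real.pi) = Θ s + 2 * Real.pi) ∧ ∀ s ∈ Set.Icc 0 (4 * Real.pi), ℓ s ≠ c ∧ ℓ s - c = (‖ℓ s - c‖ : ℂ) * Complex.exp (Θ s * Complex.I) := by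
  intro D N ℓ t c K' hN hc hℓc hper hinj ht0 htlt htper hseg haff harg hargsum hK' hcK' hfrK'
  have hπ := Real.pi_pos
  -- piece vectors and unit directions
  set V : ℕ → ℂ := fun j => ℓ (t (j + 1)) - ℓ (t j) with hV
  have hVne : ∀ j, V j ≠ 0 := fun j => sub_ne_zero.2 (hseg j).1.symm
  have hVpos : ∀ j, (0:ℝ) < ‖V j‖ := fun j => norm_pos_iff.2 (hVne j)
  set u : ℕ → ℂ := fun j => V j / (‖V j‖ : ℂ) with hu
  have hu1 : ∀ j, ‖u j‖ = 1 := fun j => by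
    rw [hu]; simp only; rw [norm_div, norm_real, Real.norm_eq_abs, abs_of_pos (hVpos j), div_self (hVpos j).ne']
  have hune : ∀ j, u j ≠ 0 := fun j => fun h => by have := hu1 j; rw [h, norm_zero] at this; exact zero_ne_one this
  have hVu : ∀ j, V j = (‖V j‖ : ℂ) * u j := fun j => by
    rw [hu]; simp only; rw [mul_div_cancel₀ _ (by exact_mod_cast (hVpos j).ne')]
  set ε : ℕ → ℝ := fun j => (V (j + 1) / V j).arg with hε
  -- the turning relation for the unit directions
  have hturn : ∀ j, u (j + 1) = u j * exp (ε j * I) := by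
    intro j
    have hq : u (j + 1) / u j = ((‖V j‖ / ‖V (j + 1)‖ : ℝ) : ℂ) * (V (j + 1) / V j) := by
      simp only [hu]
      have h1 : (‖V j‖ : ℂ) ≠ 0 := by exact_mod_cast (hVpos j).ne'
      have h2 : (‖V (j + 1)‖ : ℂ) ≠ 0 := by exact_mod_cast (hVpos (j + 1)).ne'
      push_cast
      field_simp
    have hnorm : ‖u (j + 1) / u j‖ = 1 := by rw [norm_div, hu1, hu1, div_one]
    have hargq : (u (j + 1) / u j).arg = ε j := by
      rw [hq, arg_real_mul _ (div_pos (hVpos j) (hVpos (j + 1)))]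
    have := norm_mul_exp_arg_mul_I (u (j + 1) / u j)
    rw [hnorm, hargq, ofReal_one, one_mul] at this
    rw [this, mul_div_left_comm, div_self (hune j), mul_one]
  -- hypotheses of the one-period statement
  have ht2π : t N = 2 * Real.pi := by rw [show N = 0 + N from (zero_add N).symm, htper 0, ht0, zero_add]
  have huN : u N = u 0 := by
    simp only [hu, hV]
    rw [show N + 1 = 1 + N by ring, htper 1, hper, ht2π, show (2 * Real.pi : ℝ) = 0 + 2 * Real.pi by ring, hper, ← ht0]
  have hεb : ∀ j < N, 0 ≤ ε j ∧ ε j < Real.pi := by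
    intro j _
    rcases harg j with h | h
    · have : ε j = 0 := h; rw [this]; exact ⟨le_rfl, hπ⟩
    · have : ε j = Real.pi / 2 := h; rw [this]; constructor <;> linarith
  have hmove : ∀ j < N, ∀ s s' : ℝ, t j ≤ s → s ≤ s' → s' ≤ t (j + 1) → ∃ r : ℝ, 0 ≤ r ∧ ℓ s' - ℓ s = r * u j := by
    intro j _ s s' h1 h2 h3
    have hΔ : 0 < t (j + 1) - t j := by linarith [htlt j]
    refine ⟨(s' - s) / (t (j + 1) - t j) * ‖V j‖, mul_nonneg (div_nonneg (by linarith) hΔ.le) (norm_nonneg _), ?_⟩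
    have e1 := haff j s' (h1.trans h2) h3
    have e2 := haff j s h1 (h2.trans h3)
    rw [e1, e2, show ℓ (t (j + 1)) - ℓ (t j) = V j from rfl]
    have hΔc : ((t (j + 1) - t j : ℝ) : ℂ) ≠ 0 := by exact_mod_cast hΔ.ne'
    calc ℓ (t j) + (((s' - t j) / (t (j + 1) - t j) : ℝ) : ℂ) * V j -
          (ℓ (t j) + (((s - t j) / (t (j + 1) - t j) : ℝ) : ℂ) * V j)
        = (((s' - s) / (t (j + 1) - t j) : ℝ) : ℂ) * V j := by push_cast at hΔc ⊢; field_simp; ring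
      _ = (((s' - s) / (t (j + 1) - t j) * ‖V j‖ : ℝ) : ℂ) * u j := by
          conv_lhs => rw [hVu j]
          push_cast; ring
  have hleft : ∀ j < N, 0 < ((c - ℓ (t j)) * conj (u j)).im := by
    intro j _
    have h := (hseg j).2.2.2.2 c hc
    have : (c - ℓ (t j)) * conj (u j) = (((‖V j‖)⁻¹ : ℝ) : ℂ) * ((c - ℓ (t j)) * conj (V j)) := by
      simp only [hu]; rw [map_div₀, conj_ofReal]; push_cast; field_simp
    rw [this, im_ofReal_mul]
    exact mul_pos (inv_pos.2 (hVpos j)) h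
  obtain ⟨θ₀, hθc, hθm, hθ2π, hpol⟩ := monotoneArg_of_pieces ℓ c N t u ε hℓc.continuousOn
    (by rw [show (2 * Real.pi : ℝ) = 0 + 2 * Real.pi by ring, hper]) ht0 ht2π (fun j _ => (htlt j).le)
    (fun j _ => hune j) huN hεb (fun j _ => hturn j) hargsum hmove hleft
  -- strict monotonicity on one period
  have hstrict : StrictMonoOn θ₀ (Icc 0 (2 * Real.pi)) := by
    intro s hs s' hs' hss'
    refine lt_of_le_of_ne (hθm hs hs' hss'.le) fun heq => ?_
    obtain ⟨hne, hps⟩ := hpol s hs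
    obtain ⟨hne', hps'⟩ := hpol s' hs'
    have hn : 0 < ‖ℓ s - c‖ := norm_pos_iff.2 (sub_ne_zero.2 hne)
    have hn' : 0 < ‖ℓ s' - c‖ := norm_pos_iff.2 (sub_ne_zero.2 hne')
    have hray : ℓ s' - c = ((‖ℓ s' - c‖ / ‖ℓ s - c‖ : ℝ) : ℂ) * (ℓ s - c) := by
      have hA : (‖ℓ s - c‖ : ℂ) ≠ 0 := by exact_mod_cast hn.ne'
      have e2 : ℓ s' - c = (‖ℓ s' - c‖ : ℂ) * exp (θ₀ s * I) := by rw [heq]; exact hps'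
      calc ℓ s' - c = (‖ℓ s' - c‖ : ℂ) * exp (θ₀ s * I) := e2
        _ = ((‖ℓ s' - c‖ / ‖ℓ s - c‖ : ℝ) : ℂ) * ((‖ℓ s - c‖ : ℂ) * exp (θ₀ s * I)) := by push_cast; field_simp
        _ = ((‖ℓ s' - c‖ / ‖ℓ s - c‖ : ℝ) : ℂ) * (ℓ s - c) := by rw [← hps]
    have hEq : ℓ s = ℓ s' := eq_of_frontier_of_sameRay hK' hcK' (hfrK' s) (hfrK' s') (div_pos hn' hn) hray
    rcases hs'.2.eq_or_lt with h2π | hlt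
    · -- `s' = 2π`: then `ℓ s = ℓ 0`, so `s = 0`, contradicting `θ₀ (2π) = θ₀ 0 + 2π`
      have h0 : ℓ s = ℓ 0 := by rw [hEq, h2π, show (2 * Real.pi : ℝ) = 0 + 2 * Real.pi by ring, hper]
      have hs0 : s = 0 := hinj ⟨hs.1, lt_of_lt_of_le hss' hs'.2⟩ ⟨le_rfl, by positivity⟩ h0
      rw [hs0, h2π, hθ2π] at heq; linarith
    · exact absurd (hinj ⟨hs.1, lt_of_lt_of_le hss' hs'.2⟩ ⟨hs'.1, hlt⟩ hEq) hss'.ne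
  -- two periods
  obtain ⟨Θ, hΘc, -, hΘ1, hΘ2, hΘpol, hΘstrict⟩ := arg_extend ℓ c θ₀ (by positivity : (0:ℝ) < 2 * Real.pi) hper hθc
    hθm hθ2π (fun s hs => (hpol s hs).2)
  refine ⟨Θ, by rwa [show 4 * Real.pi = 2 * (2 * Real.pi) by ring], by
    rw [show 4 * Real.pi = 2 * (2 * Real.pi) by ring]; exact hΘstrict hstrict, fun s hs => by
    rw [hΘ2 s hs, hΘ1 s hs], fun s hs => ⟨?_, hΘpol s (by rwa [show 2 * (2 * Real.pi) = 4 * Real.pi by ring])⟩⟩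
  -- `ℓ s ≠ c`: reduce to one period
  by_cases h1 : s ≤ 2 * Real.pi
  · exact (hpol s ⟨hs.1, h1⟩).1
  · have := (hpol (s - 2 * Real.pi) ⟨by linarith [not_le.1 h1], by linarith [hs.2]⟩).1
    rwa [← hper (s - 2 * Real.pi), sub_add_cancel] at this

/-! ## The argument of the boundary trace -/

/-- **The argument of the boundary trace about an interior point of the limit polygon, over two periods.** -/
theorem exists_traceArg : ∀ (N : ℕ) (ℓ : ℝ → ℂ) (t : ℕ → ℝ) (G : ℂ → ℂ) (w₀ : ℂ) (d : ℕ → ℂ) (θ : ℕ → ℝ), 0 < N → (∀ s : ℝ, ℓ (s + 2 * Real.pi) = ℓ s) → ContinuousOn (fun s => G (ℓ s)) (Set.Icc 0 (2 * Real.pi)) → t 0 = 0 → (∀ j, t j < t (j + 1)) → (∀ j, t (j + N) = t j + 2 * Real.pi) → d 0 ≠ 0 → (∀ j, d (j + 1) = d j * Complex.exp (θ j * Complex.I)) → (∀ j, 0 ≤ θ j ∧ θ j < Real.pi) → ∑ j ∈ Finset.range N, θ j = 2 * Real.pi → (∀ (j : ℕ) (s s' : ℝ), t j ≤ s → s ≤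 s' → s' ≤ t (j + 1) → ∃ r : ℝ, 0 ≤ r ∧ G (ℓ s') - G (ℓ s) = r * d j) → (∀ j : ℕ, 0 < ((w₀ - G (ℓ (t j))) * (starRingEnd ℂ) (d j)).im) → ∃ Θ : ℝ → ℝ, ContinuousOn Θ (Set.Icc 0 (4 * Real.pi)) ∧ MonotoneOn Θ (Set.Icc 0 (4 * Real.pi)) ∧ (∀ s ∈ Set.Icc 0 (2 * Real.pi), Θ (s + 2 * Real.pi) = Θ s + 2 * Real.pi) ∧ ∀ s ∈ Set.Icc 0 (4 * Real.pi), G (ℓ s) ≠ w₀ ∧ G (ℓ s) - w₀ = (‖G (ℓ s) - w₀‖ : ℂ) * Complex.exp (Θ s * Complex.I) := by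
  intro N ℓ t G w₀ d θ hN hper hGc ht0 htlt htper hd0 hd hθ hθsum hmono hleft
  have hπ := Real.pi_pos
  obtain ⟨hdN, hdne⟩ := dir_closes hd hθsum hd0
  have ht2π : t N = 2 * Real.pi := by rw [show N = 0 + N from (zero_add N).symm, htper 0, ht0, zero_add]
  have hγper : ∀ s, G (ℓ (s + 2 * Real.pi)) = G (ℓ s) := fun s => by rw [hper]
  obtain ⟨θ₀, hθc, hθm, hθ2π, hpol⟩ := monotoneArg_of_pieces (fun s => G (ℓ s)) w₀ N t d θ hGc
    (by simpa using hγper 0) ht0 ht2π (fun j _ => (htlt j).le)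
    (fun j _ => hdne j) hdN (fun j _ => hθ j) (fun j _ => hd j) hθsum (fun j _ => hmono j) (fun j _ => hleft j)
  obtain ⟨Θ, hΘc, hΘm, hΘ1, hΘ2, hΘpol, -⟩ := arg_extend (fun s => G (ℓ s)) w₀ θ₀ (by positivity : (0:ℝ) < 2 * Real.pi)
    hγper hθc hθm hθ2π (fun s hs => (hpol s hs).2)
  refine ⟨Θ, by rwa [show 4 * Real.pi = 2 * (2 * Real.pi) by ring], by
    rwa [show 4 * Real.pi = 2 * (2 * Real.pi) by ring], fun s hs => by rw [hΘ2 s hs, hΘ1 s hs], fun s hs => ⟨?_,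
    hΘpol s (by rwa [show 2 * (2 * Real.pi) = 4 * Real.pi by ring])⟩⟩
  by_cases h1 : s ≤ 2 * Real.pi
  · exact (hpol s ⟨hs.1, h1⟩).1
  · have := (hpol (s - 2 * Real.pi) ⟨by linarith [not_le.1 h1], by linarith [hs.2]⟩).1
    rwa [← hγper (s - 2 * Real.pi), sub_add_cancel] at this

end Summit.CriticalPhenomena.CardyFormulaZ2.Cruxes.ParafermionToSLESixFamilies.PotentialDarbouxPicardDiamond

end
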